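import Summits.BirchSwinnertonDyer.BirchSwinnertonDyer.Theorems.InertBadSignedBranchesCccOneLawOnTypeIstarZeroPackageRigidity
import HarnessLib

set_option linter.dupNamespace false
set_option autoImplicit false

/-!
# `CccOneLawOnTypeIstarZero` (stmt-BirchSwinnertonDyer-19223), line `kato_perrin_riou_istar` v11, research stub 2c —
# UNIT RESCALING of Kobayashi packages: why the value law is «∃ package», never «∀ package»

Refill hand `leafhand-bsd-inertbadsignedbran-5` g0 (prover), 2026-08-31; DEF-FREE helper `--supports 19223 --as helper`;
companion of `…PackageRigidity.lean` (p827306) and `…PackageRigidityValueLaw.lean` (p827380).  Skeleton of record v11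
`d5290a4395abfc6e`.  Nothing registered, no stub closed, nothing asserted about the open items; BSD is proved for no curve.

## What this file proves (kernel, unconditional)

The hypothesis structure `Kobayashi2003.EtaColemanPoitouTateData` (class `z`, injective `Col^± ∘ loc`, Thm. 6.3 at `z`,
the exact sequences (7.21), Cor. 7.2) is CLOSED UNDER RESCALING BY UNITS of `Λ`: for every package `P` and every `w ∈ Λˣ`
there is a package `P′` with `P′.z = w⁻¹ • P.z`, `P′.colPlus = w • P.colPlus`, `P′.colMinus = w • P.colMinus`
(`exists_rescaled_package`) — all printed clauses are insensitive to the rescaling (`Col(P.z)` is unchanged, images are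
unchanged, injectivity is unchanged).  Consequences for the research stub 2c `stub_muColPlusAdmissibleIstarZero`:
* `exists_package_colPlus_eq_units_mul` — for every class `z₀` and unit `w` some package has `P′.colPlus z₀ = w·(P.colPlus z₀)`;
  (`1 + X` is such a unit, non-constant — cf. the landed `ChromaticIotaDescent.isUnit_one_add_X`, re-derived inline);
* `not_forall_packages_isPlus_colPlus` — for `z₀ ≠ 0` (e.g. admissible) it is FALSE that EVERY package has the value law
  `IsQuadraticBranchPlusLFunction f p ϖ (P′.colPlus z₀)`: rescaling by the non-constant unit `1 + X` would force
  `(1 + X)·L = c·L` with a constant `c ∈ ℤ_pˣ` (plus functions are unique up to `ℤ_pˣ`), i.e. `L = 0`.  Hence the typed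
  residual of stub 2c must be the EXISTENTIAL value law of `CccOnePackageRigidity.stub2c_of_valueLaw` (p827380) — «SOME
  package (the genuine `(ε_η z_{η(−1)}, Col⁺∘loc)`) has the value law» — and a typer must NOT add the value law as a field
  expected of every inhabitant without pinning `z`;
* `not_forall_admissible_isPlus_colPlus` — nor can the value law hold at every ADMISSIBLE class for a FIXED package (the
  admissible set is closed under `Λˣ`, `IsAdmissibleZetaClass.units_smul`); so the satisfiable typed form is
  «∀ admissible z₀, ∃ package P, value law» — and `forall_admissible_exists_package_isPlus_colPlus`: granted ★
  `exists_zetaClassPosition_of_rank_le_one` and `rank_Λ 𝐇¹_Γ ≤ 1`, ONE instance `(P₀, z₀)` per pin gives it for every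
  admissible class (rescale `P₀`).  CORRECTION OF RECORD: the hypothesis `hVL` of `stub2c_of_valueLaw` (p827380) is written
  «∃ P₀, ∀ admissible z₀», which by `not_forall_admissible_isPlus_colPlus` is UNSATISFIABLE on any pin carrying an admissible
  class (the theorem is true but idle); the companion `stub2c_of_valueLaw'` (appended to that file) carries the satisfiable
  «∀ admissible z₀, ∃ P₀» form with the same one-line proof.
* stub 2c itself IS rescaling-invariant (`CccOnePackageRigidity.stub2c_iff_of_packages`, p827306), consistent with the above.
Honest label: bookkeeping; closes no stub; 19223 OPEN.
-/

noncomputable section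

open scoped Classical

open CongruenceSubgroup WeierstrassCurve Field Literature.NumberTheory.EllipticCurves
  Literature.NumberTheory.EllipticCurves.ModularForms Literature.NumberTheory.EllipticCurves.IwasawaAlgebra
  Literature.NumberTheory.EllipticCurves.Kato2004 ZpExtension Module
  Summit.BirchSwinnertonDyer.BirchSwinnertonDyer.Theses.InertBadSignedBranches
  Summit.BirchSwinnertonDyer.Rank1Residual

namespace Summit.BirchSwinnertonDyer.BirchSwinnertonDyer.Theorems.CccOnePackageRigidity

variable {p : ℕ} [Fact p.Prime]

section Rescale

variable {K₀ : Type} [Field K₀] [NumberField K₀] [(galRange (K := ℚ) K₀).Normal]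
  {η : absoluteGaloisGroup ℚ →* ℤˣ} {V : WeierstrassCurve ℚ} [V.IsElliptic] {N : ℕ} {f : CuspForm (Gamma0 N) 2}
  {ϖ : ℚ} {κ : ZpExtension ℚ p} {γ : absoluteGaloisGroup ℚ} {W : WeierstrassCurve ℚ} [W.IsElliptic]
  [ContinuousSMul ℤ_[p] (W.tateModule p)] {I : Kato2004.IwasawaH1Data W p κ γ} {FB : W.FineSelmerDualData κ γ}

/-- The range of `w • c` is the range of `c` for a unit `w` of the (commutative) scalar ring. [folklore] -/
theorem range_units_smul_eq (c : I.H →ₗ[IwasawaAlgebra p] IwasawaAlgebra p) (w : (IwasawaAlgebra p)ˣ) :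
    LinearMap.range ((w : IwasawaAlgebra p) • c) = LinearMap.range c := by
  apply le_antisymm
  · rintro y ⟨x, rfl⟩
    exact ⟨(w : IwasawaAlgebra p) • x, by rw [map_smul, LinearMap.smul_apply]⟩
  · rintro y ⟨x, rfl⟩
    refine ⟨((w⁻¹ : (IwasawaAlgebra p)ˣ) : IwasawaAlgebra p) • x, ?_⟩
    rw [LinearMap.smul_apply, map_smul, smul_smul, Units.mul_inv, one_smul]

/-- Exactness `H →ᶜ Λ →ʲ X` is insensitive to rescaling `c` by a unit. [folklore] -/
theorem exact_units_smul_of_exact {X : Type*} [AddCommGroup X] [Module (IwasawaAlgebra p) X]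
    {c : I.H →ₗ[IwasawaAlgebra p] IwasawaAlgebra p} {j : IwasawaAlgebra p →ₗ[IwasawaAlgebra p] X}
    (h : Function.Exact c j) (w : (IwasawaAlgebra p)ˣ) : Function.Exact ((w : IwasawaAlgebra p) • c) j := by
  rw [LinearMap.exact_iff] at h ⊢
  rw [h, range_units_smul_eq c w]

/-- Injectivity is insensitive to rescaling by a unit. [folklore] -/
theorem injective_units_smul_of_injective {c : I.H →ₗ[IwasawaAlgebra p] IwasawaAlgebra p}
    (hc : Function.Injective c) (w : (IwasawaAlgebra p)ˣ) :
    Function.Injective ((w : IwasawaAlgebra p) • c) := by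
  intro x y hxy
  apply hc
  have : (w : IwasawaAlgebra p) * c x = (w : IwasawaAlgebra p) * c y := by
    simpa only [LinearMap.smul_apply, smul_eq_mul] using hxy
  exact (IsUnit.mul_right_inj w.isUnit).mp this

/-- `(w • c) (w⁻¹ • z) = c z`. [folklore] -/
theorem units_smul_apply_inv_smul (c : I.H →ₗ[IwasawaAlgebra p] IwasawaAlgebra p) (w : (IwasawaAlgebra p)ˣ)
    (z : I.H) :
    ((w : IwasawaAlgebra p) • c) (((w⁻¹ : (IwasawaAlgebra p)ˣ) : IwasawaAlgebra p) • z) = c z := by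
  rw [LinearMap.smul_apply, map_smul, smul_smul, Units.mul_inv, one_smul]

/-- **Kobayashi packages are closed under rescaling by units of `Λ`.**  For every package `P` on `(I, FB)` and every
`w ∈ Λˣ` there is a package `P′` on the same `(I, FB)` with `P′.z = w⁻¹ • P.z`, `P′.colPlus = w • P.colPlus` and
`P′.colMinus = w • P.colMinus`: the value `Col⁺(z)` (hence Thm. 6.3's pinning), the images of `Col^±` (hence (7.21)) and
injectivity (Thm. 7.3 i)) are all unchanged.  So the structure pins the pair `(z, Col⁺∘loc)` only up to this action — the
reason the value law on admissible classes is an «∃ package» statement. [cite: Kobayashi2003, Thm. 6.3 (p. 11), Thm. 7.3 i) (7.21) and Cor. 7.2 (p. 13)] -/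
theorem exists_rescaled_package (P : Kobayashi2003.EtaColemanPoitouTateData p K₀ η V f ϖ κ γ W I FB)
    (w : (IwasawaAlgebra p)ˣ) :
    ∃ P' : Kobayashi2003.EtaColemanPoitouTateData p K₀ η V f ϖ κ γ W I FB,
      P'.z = ((w⁻¹ : (IwasawaAlgebra p)ˣ) : IwasawaAlgebra p) • P.z ∧
        P'.colPlus = (w : IwasawaAlgebra p) • P.colPlus ∧ P'.colMinus = (w : IwasawaAlgebra p) • P.colMinus := by
  refine ⟨{ z := ((w⁻¹ : (IwasawaAlgebra p)ˣ) : IwasawaAlgebra p) • P.z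
            isTorsion_fine := P.isTorsion_fine
            colPlus := (w : IwasawaAlgebra p) • P.colPlus
            colPlus_injective := injective_units_smul_of_injective P.colPlus_injective w
            isPlus_colPlus_z := by
              rw [units_smul_apply_inv_smul]
              exact P.isPlus_colPlus_z
            exact_plus := fun D => by
              obtain ⟨j, k, hcj, hjk, hk⟩ := P.exact_plus D
              exact ⟨j, k, exact_units_smul_of_exact hcj w, hjk, hk⟩
            colMinus := (w : IwasawaAlgebra p) • P.colMinus
            colMinus_injective := injective_units_smul_of_injective P.colMinus_injective w
            isMinus_X_mul_colMinus_z := by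
              rw [units_smul_apply_inv_smul]
              exact P.isMinus_X_mul_colMinus_z
            exact_minus := fun D => by
              obtain ⟨j, k, hcj, hjk, hk⟩ := P.exact_minus D
              exact ⟨j, k, exact_units_smul_of_exact hcj w, hjk, hk⟩ }, rfl, rfl, rfl⟩

/-- **Every unit multiple of `Col⁺(loc z₀)` is the `Col⁺`-value of `z₀` in SOME package.**
[cite: Kobayashi2003, Thm. 6.3 (p. 11), Thm. 7.3 i) (p. 13)] -/
theorem exists_package_colPlus_eq_units_mul (P : Kobayashi2003.EtaColemanPoitouTateData p K₀ η V f ϖ κ γ W I FB)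
    (w : (IwasawaAlgebra p)ˣ) (z₀ : I.H) :
    ∃ P' : Kobayashi2003.EtaColemanPoitouTateData p K₀ η V f ϖ κ γ W I FB,
      P'.colPlus z₀ = (w : IwasawaAlgebra p) * P.colPlus z₀ := by
  obtain ⟨P', -, hP', -⟩ := exists_rescaled_package P w
  exact ⟨P', by rw [hP', LinearMap.smul_apply, smul_eq_mul]⟩

/-- **The value law cannot hold at EVERY package** (unless the class is zero): for `z₀` with `P.colPlus z₀ ≠ 0` — every
`z₀ ≠ 0`, `Col⁺` being injective; in particular every admissible class — it is false that `P′.colPlus z₀` is a plus function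
`L_p⁺(V, η, X)` for all packages `P′` on the pin: the package rescaled by the non-constant unit `1 + X` would give
`(1 + X)·L` and `L` both plus functions, which differ by a CONSTANT unit of `ℤ_p` (`IsQuadraticBranchPlusLFunction.exists_units_smul_eq`),
forcing `L = 0`.  Moral for the typer of stub 2c's residual: type «∃ package with the value law» (as in
`CccOnePackageRigidity.stub2c_of_valueLaw`), not a field expected of every package.
[cite: Kobayashi2003, Thm. 3.2 (p. 7), Thm. 6.3 (p. 11), Thm. 7.3 i) (p. 13)] -/
theorem not_forall_packages_isPlus_colPlus (hp : p ≠ 2)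
    (P : Kobayashi2003.EtaColemanPoitouTateData p K₀ η V f ϖ κ γ W I FB) {z₀ : I.H} (hz₀ : z₀ ≠ 0) :
    ¬ ∀ P' : Kobayashi2003.EtaColemanPoitouTateData p K₀ η V f ϖ κ γ W I FB,
        Kobayashi2003.IsQuadraticBranchPlusLFunction f p ϖ (P'.colPlus z₀) := by
  intro h
  set L := P.colPlus z₀ with hL
  have hL0 : L ≠ 0 := fun h0 => hz₀ (P.colPlus_injective (by rw [← hL, h0, map_zero]))
  -- `1 + X` is a unit of `Λ` (constant coefficient `1`; cf. `ChromaticIotaDescent.isUnit_one_add_X`) and not a constant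
  have hu : IsUnit (1 + PowerSeries.X : IwasawaAlgebra p) := by
    rw [PowerSeries.isUnit_iff_constantCoeff, map_add, map_one, PowerSeries.constantCoeff_X, add_zero]
    exact isUnit_one
  obtain ⟨P', hP'⟩ := exists_package_colPlus_eq_units_mul P hu.unit z₀
  have h₁ : Additive.IsQuadraticBranchPlusLFunction f p ϖ L := h P
  have h₂ : Additive.IsQuadraticBranchPlusLFunction f p ϖ ((1 + PowerSeries.X) * L) := by
    have := h P'
    rw [hP', IsUnit.unit_spec] at this
    exact this
  obtain ⟨c, hc⟩ := Additive.IsQuadraticBranchPlusLFunction.exists_units_smul_eq hp h₁ h₂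
  -- `(1 + X) L = c • L = C c * L`, so `(1 + X - C c) * L = 0`, so `1 + X = C c`: compare the coefficients of `X`
  rw [PowerSeries.smul_eq_C_mul] at hc
  have hdiff : (1 + PowerSeries.X - PowerSeries.C (c : ℤ_[p])) * L = 0 := by rw [sub_mul, hc, sub_self]
  have hfac : (1 + PowerSeries.X - PowerSeries.C (c : ℤ_[p]) : IwasawaAlgebra p) = 0 :=
    (mul_eq_zero.mp hdiff).resolve_right hL0
  have h1 := congrArg (PowerSeries.coeff 1) hfac
  rw [map_sub, map_add, PowerSeries.coeff_one_X, PowerSeries.coeff_C, if_neg one_ne_zero, PowerSeries.coeff_one,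
    if_neg one_ne_zero, map_zero] at h1
  norm_num at h1

end Rescale

/-! ## The admissible side: the value law is «∀ admissible z₀, ∃ package», and one instance per pin suffices -/

section Admissible

variable {K₀ : Type} [Field K₀] [NumberField K₀] [(galRange (K := ℚ) K₀).Normal]
  {η : absoluteGaloisGroup ℚ →* ℤˣ} {V : WeierstrassCurve ℚ} [V.IsElliptic] {N : ℕ} {f : CuspForm (Gamma0 N) 2}
  {ϖ : ℚ} {κ : ZpExtension ℚ p} {hκ : κ.IsCyclotomic} {γ : absoluteGaloisGroup ℚ} {W : WeierstrassCurve ℚ} [W.IsElliptic]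
  [W.IsGloballyMinimal] [ContinuousSMul ℤ_[p] (W.tateModule p)] {I : Kato2004.IwasawaH1Data W p κ γ}
  {FB : W.FineSelmerDualData κ γ}

/-- **…nor at every ADMISSIBLE class for a fixed package.**  The admissible classes of a pin are closed under `Λˣ`
(`Kato2004.IsAdmissibleZetaClass.units_smul`), so for a FIXED package `P` the value law cannot hold at every admissible class
either (`z₀` and `(1 + X)•z₀` are both admissible; their `Col⁺`-values differ by the non-constant unit `1 + X`).  Hence the
only satisfiable typed form of the residual of stub 2c is «for every admissible `z₀` there is SOME package `P` with
`IsQuadraticBranchPlusLFunction f p ϖ (P.colPlus z₀)`» (`forall_admissible_exists_package_isPlus_colPlus` shows one instance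
per pin suffices for it), which is the hypothesis of `CccOnePackageRigidity.stub2c_of_valueLaw'` (companion file).
[cite: Kato2004Asterisque, Thm. 12.5 (1) (p. 221), §13.9 (p. 230 l. 4–9)] [cite: Kobayashi2003, Thm. 3.2 (p. 7), Thm. 6.3 (p. 11)] -/
theorem not_forall_admissible_isPlus_colPlus (hp : p ≠ 2) (hγ : κ.IsTopGenerator γ)
    (P : Kobayashi2003.EtaColemanPoitouTateData p K₀ η V f ϖ κ γ W I FB) {z₀ : I.H}
    (hz₀ : IsAdmissibleZetaClass W p κ hκ I z₀) :
    ¬ ∀ z : I.H, IsAdmissibleZetaClass W p κ hκ I z →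
        Kobayashi2003.IsQuadraticBranchPlusLFunction f p ϖ (P.colPlus z) := by
  intro h
  have hu : IsUnit (1 + PowerSeries.X : IwasawaAlgebra p) := by
    rw [PowerSeries.isUnit_iff_constantCoeff, map_add, map_one, PowerSeries.constantCoeff_X, add_zero]
    exact isUnit_one
  set L := P.colPlus z₀ with hL
  have hz₀0 : z₀ ≠ 0 := CccOneCollinearMu.ne_zero_of_isAdmissibleZetaClass I hγ hz₀
  have hL0 : L ≠ 0 := fun h0 => hz₀0 (P.colPlus_injective (by rw [← hL, h0, map_zero]))
  have h₁ : Additive.IsQuadraticBranchPlusLFunction f p ϖ L := h z₀ hz₀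
  have h₂ : Additive.IsQuadraticBranchPlusLFunction f p ϖ ((1 + PowerSeries.X) * L) := by
    have := h ((hu.unit : IwasawaAlgebra p) • z₀) (hz₀.units_smul hu.unit)
    rw [map_smul, smul_eq_mul, IsUnit.unit_spec] at this
    exact this
  obtain ⟨c, hc⟩ := Additive.IsQuadraticBranchPlusLFunction.exists_units_smul_eq hp h₁ h₂
  rw [PowerSeries.smul_eq_C_mul] at hc
  have hdiff : (1 + PowerSeries.X - PowerSeries.C (c : ℤ_[p])) * L = 0 := by rw [sub_mul, hc, sub_self]
  have hfac : (1 + PowerSeries.X - PowerSeries.C (c : ℤ_[p]) : IwasawaAlgebra p) = 0 :=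
    (mul_eq_zero.mp hdiff).resolve_right hL0
  have h1 := congrArg (PowerSeries.coeff 1) hfac
  rw [map_sub, map_add, PowerSeries.coeff_one_X, PowerSeries.coeff_C, if_neg one_ne_zero, PowerSeries.coeff_one,
    if_neg one_ne_zero, map_zero] at h1
  norm_num at h1

/-- **One instance per pin for the «∀ admissible, ∃ package» value law.**  Granted the named fact ★
`Kato2004.exists_zetaClassPosition_of_rank_le_one` (all admissible classes of a pin are `Λˣ`-multiples of each other) and
`rank_Λ 𝐇¹_Γ ≤ 1`: if ONE package `P₀` has the value law at ONE admissible class `z₀`, then EVERY admissible class `z` has the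
value law at SOME package (the rescaling of `P₀` by the unit `w` with `z = w • z₀`, `exists_rescaled_package`).
[cite: Kato2004Asterisque, Thm. 12.5 (1) (p. 221), §13.9 (p. 230 l. 4–9)] [cite: Kobayashi2003, Thm. 6.3 (p. 11), Thm. 7.3 i) (p. 13)] -/
theorem forall_admissible_exists_package_isPlus_colPlus (hstar : exists_zetaClassPosition_of_rank_le_one)
    (hγ : κ.IsTopGenerator γ) (hp : p ≠ 2) (hrank : Module.rank (IwasawaAlgebra p) I.H ≤ 1)
    (P₀ : Kobayashi2003.EtaColemanPoitouTateData p K₀ η V f ϖ κ γ W I FB) {z₀ : I.H}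
    (hz₀ : IsAdmissibleZetaClass W p κ hκ I z₀)
    (hVL : Kobayashi2003.IsQuadraticBranchPlusLFunction f p ϖ (P₀.colPlus z₀)) :
    ∀ z : I.H, IsAdmissibleZetaClass W p κ hκ I z →
      ∃ P : Kobayashi2003.EtaColemanPoitouTateData p K₀ η V f ϖ κ γ W I FB,
        Kobayashi2003.IsQuadraticBranchPlusLFunction f p ϖ (P.colPlus z) := by
  intro z hz
  obtain ⟨w, hw⟩ := hstar.admissible_eq_units_smul hκ hγ hp I hrank hz₀ hz
  obtain ⟨P, -, hP, -⟩ := exists_rescaled_package P₀ w⁻¹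
  refine ⟨P, ?_⟩
  have hval : P.colPlus z = P₀.colPlus z₀ := by
    rw [hP, hw, LinearMap.smul_apply, map_smul, smul_smul, Units.inv_mul, one_smul]
  rw [hval]
  exact hVL

end Admissible

end Summit.BirchSwinnertonDyer.BirchSwinnertonDyer.Theorems.CccOnePackageRigidity

end
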